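import Summits.MatrixMultiplication.MatrixMultiplication.Theorems.AutomaticSTPPDesignsAutomaticPackingThesisSTPPMassCap
import HarnessLib

/-!
# REVIEW-RUNBOOK sanity lemma — an explicit abelian SIMULTANEOUS-TPP family with non-empty parts
# (client `gate-prattval` of the ops review-runbook generator, card S `STPPMassCap.sum_card_mul_le_rpow`)

Card (2)(b) («non-vacuity») of `run/shared/lean/pub/gate-prattval/REVIEW-RUNBOOK.md`: the mass cap
`∑ᵢ |Aᵢ||Bᵢ||Cᵢ| ≤ |H|^{4/3}` (`STPPMassCap.sum_card_mul_le_rpow`, p396884) is stated for every family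
`(Aᵢ, Bᵢ, Cᵢ)ᵢ` of finite subsets of a finite abelian group with the (additive) simultaneous triple
product property (Cohn–Kleinberg–Szegedy–Umans 2005, Def. 5.1 = `AddSimultaneousTPP`) and all parts
non-empty.  This file records ONE closed theorem `∃ A B C, h₁ ∧ h₂ ∧ h₃ ∧ h₄` (the shape the generator's
probe matches) exhibiting such a family with TWO triples, so that clause (ii) of the STPP (the
cross-index condition) is exercised, not only the triple product property of one triple:
in `H = ℤ/3`, index set `Fin 2`,

  `A = ({0}, {0})`, `B = ({0}, {1})`, `C = ({0}, {2})`

— the design differences `u = a − c`, `v = b − a`, `w = c − b` per index are `(0,0,0)` and `(1,1,1)`,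
and `uᵢ + vⱼ + w_k = 0 (mod 3)` forces `i = j = k` (a 2-term tricoloured sum-free set in `ℤ/3`); mass
`∑ |A||B||C| = 2 ≤ 3^{4/3}`.  Kernel `decide` on the definition (no `native_decide`).

Review evidence only (`--supports`; the file closes no item); no definitions, no `sorry`, standard axioms.
-/

namespace Summit.MatrixMultiplication.MatrixMultiplication.Theorems.RunbookSTPP

open Literature.Combinatorics.Additive

/-- The two-triple family `A = ({0},{0})`, `B = ({0},{1})`, `C = ({0},{2})` in `ℤ/3` has the additive
simultaneous triple product property (CKSU 2005 Def. 5.1: each triple has the TPP — singletons — and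
`aᵢ − a'ⱼ + bⱼ − b'_k + c_k − c'ᵢ = 0` forces `i = j = k`). Kernel `decide`. [folklore] -/
theorem addSimultaneousTPP_zmod3_pair :
    AddSimultaneousTPP (![{0}, {0}] : Fin 2 → Finset (ZMod 3)) ![{0}, {1}] ![{0}, {2}] := by
  simp only [AddSimultaneousTPP, AddTripleProductProperty, Fin.forall_fin_two, Matrix.cons_val_zero,
    Matrix.cons_val_one, Finset.mem_singleton, forall_eq]
  decide

/-- (b) **The four hypotheses of `STPPMassCap.sum_card_mul_le_rpow` hold together, with two triples**:
`H = ℤ/3` (a finite abelian group with decidable equality), `ι = Fin 2`, the family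
`A = ({0},{0})`, `B = ({0},{1})`, `C = ({0},{2})` is an additive STPP family
(`addSimultaneousTPP_zmod3_pair`) and every `Aᵢ`, `Bᵢ`, `Cᵢ` is non-empty.  (At this instance the
mass cap reads `2 ≤ 3^{4/3}`.) [folklore] -/
theorem sum_card_mul_le_rpow_hypotheses :
    ∃ A B C : Fin 2 → Finset (ZMod 3),
      AddSimultaneousTPP A B C ∧ (∀ i, (A i).Nonempty) ∧ (∀ i, (B i).Nonempty) ∧
        (∀ i, (C i).Nonempty) :=
  ⟨![{0}, {0}], ![{0}, {1}], ![{0}, {2}], addSimultaneousTPP_zmod3_pair,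
    fun i => by fin_cases i <;> simp, fun i => by fin_cases i <;> simp, fun i => by fin_cases i <;> simp⟩

end Summit.MatrixMultiplication.MatrixMultiplication.Theorems.RunbookSTPP
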